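import Literature.NumberTheory.EllipticCurves.PadicSigmaThreeIntegralityProofs
import Literature.NumberTheory.EllipticCurves.PadicSigmaThreeFormalIsogeny
import Literature.NumberTheory.EllipticCurves.PadicSigmaThreeReductionProofs
import Literature.RingTheory.HenselLemma.NewtonContraction
import Mathlib.Algebra.Polynomial.Identities
import HarnessLib

/-!
# The Mazur–Tate sigma pair EXISTS at `p = 3`: `mazur_tate_sigma_exists_odd_holds` — the Frobenius lift
# of `R̂₃`, Blakestad–Grant's Thm. 1 for the universal ordinary `a₂`-curve, the specialisation to every
# ordinary `a₂`-model over `ℤ₃`, and the unconditional consequences at every odd good ordinary prime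

Trunk T-NT-EC (Literature/NumberTheory/EllipticCurves). THE ASSEMBLY of the `p = 3` case of the named fact
`Literature.NumberTheory.EllipticCurves.mazur_tate_sigma_exists_odd` (`PadicSigmaOddPrime.lean`):
* §1 a one-variable Hensel lemma in an `I`-adically complete ring (`Universal.exists_root_of_newton`, the
  tree's multivariate `existsUnique_zero_of_newton` with one unknown); `Universal.frobY`: the root
  `Y' ≡ Y³ (mod 3)` of the quartic of the quotient model `𝓔'` (`Q_{𝓔'}(Y³) ≡ Y⁹(Y³ + a₂') ≡ Y⁹(Y + a₂)³ ≡ 0`,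
  `Q'_{𝓔'} ≡ Y⁹` a unit); `Universal.frobeniusLift = specialize Y' a₄' a₆'`, an endomorphism `α` of `R̂₃`
  with `α ≡ Frob (mod 3)` and `α_*𝓔 = 𝓔'` (`universalCurve_map_frobeniusLift`);
* §2 `Universal.coeff_exp_sigmaExpArg_mem_intSubring` — Blakestad–Grant's Thm. 1 for the universal
  ordinary `a₂`-curve over `R̂₃`: the isogeny data of `PadicSigmaThreeFormalIsogeny.lean` at the universal
  chart fed to `coeff_exp_sigmaExpArg_universalCurve_mem'` (`PadicSigmaThreeIntegralityProofs.lean`);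
* §3 the specialisation (Blakestad–Grant Thm. 15 for the chart): for a `3`-integral `a₂`-model `V/ℚ₃` with
  unit `w₂ = a₂`, Hensel in `ℤ₃` gives `y₀ ≡ -a₂` with `Ψ₃(y₀/3) = 0`, `ρ = specialize y₀ a₄ a₆` carries `𝓔`
  to the integral model of `V`, the universal even zeta series specialises, `ρ_K(exp ∫ζ̃ω)` is `3`-integral,
  and `isMazurTateSigmaPair_sigmaOfZeta` gives the pair — `PadicSigmaThree.exists_isMazurTateSigmaPair_three`;
  with `mazur_tate_sigma_exists_odd_of_exists_charNeTwoNF_three` (`PadicSigmaThreeReductionProofs.lean`):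
  **`Literature.NumberTheory.EllipticCurves.mazur_tate_sigma_exists_odd_holds : mazur_tate_sigma_exists_odd`**
  (DISCHARGE of the named fact; `p ≥ 5` is the tree's `mazur_tate_sigma_existsUnique_holds`);
* Part `PadicSigmaThreeConsequences`: the unconditional forms of `PadicSigmaOddPrime.lean`'s conditional
  theorems — `PadicSigmaThree.mazur_tate_sigma_existsUnique_odd`, `isMazurTateSigmaPair_padicSigma_odd`,
  `exists_isCanonical_odd`, `existsUnique_isCanonical_odd` (the Mazur–Tate pair, that the chosen
  `padicSigma` IS a pair, and THE canonical cyclotomic `p`-adic height datum, at every odd good ordinary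
  prime of every elliptic curve over `ℚ`).

## Sources

* B. Mazur, J. Tate, *The `p`-adic sigma function*, Duke Math. J. 62 (1991), Thm. 3.1. [MazurTate1991]
* B. Mazur, W. Stein, J. Tate, Doc. Math. Extra Vol. Coates (2006), Thm. 1.3. [MazurSteinTate2006]
* C. Blakestad, D. Grant, J. Number Theory 249 (2023) 348–376, Thm. 1, Thm. 2, Prop. 7, Def. 8, Prop. 13,
  Thm. 15. [BlakestadGrant2023]
* J. Vélu, C. R. Acad. Sci. Paris 273 (1971). [Velu1971]
* J. S. Balakrishnan, J. Number Theory 161 (2016), §2. [Balakrishnan2016]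

Provenance. Re-homed VERBATIM (declaration bodies unchanged; namespaces
`Summit.BirchSwinnertonDyer.Rank1Residual.X1.PadicSigmaThree[.Universal]` ↦
`Literature.NumberTheory.EllipticCurves.PadicSigmaThree[.Universal]`, intra-tower imports re-pointed)
from `Summits/BirchSwinnertonDyer/Rank1Residual/X1/PadicSigmaThree*.lean` (cell `b2b-bsdres`, unit x1a,
2026-08-22), so that the discharge `Literature.NumberTheory.EllipticCurves.mazur_tate_sigma_exists_odd_holds`
of the Literature named fact `mazur_tate_sigma_exists_odd` (`PadicSigmaOddPrime.lean`) lives in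
`Literature/` (which cannot import `Summits/`; ledger promote event 10878647). The `Summits/…/X1` copies are
thereby refactor debt (to be re-pointed at these modules by a librarian); nothing here is new mathematics
relative to them. (The discharge theorem is placed in namespace `Literature.NumberTheory.EllipticCurves`, beside its
`def`; every other declaration keeps its relative name under `…PadicSigmaThree[.Universal]`.)

Design notes. Two definitions with bodies (`Universal.frobY`, `Universal.frobeniusLift`); theorems otherwise;
no named fact introduced, one named fact DISCHARGED (`mazur_tate_sigma_exists_odd`); no `sorry`; standard
axioms. Two consecutive `noncomputable section … end` blocks.
-/

/-! ## Part `PadicSigmaThreeExistence` (= `Summits/BirchSwinnertonDyer/Rank1Residual/X1/PadicSigmaThreeExistence.lean`, declarations verbatim) -/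

noncomputable section

open PowerSeries Literature.NumberTheory.EllipticCurves

namespace Literature.NumberTheory.EllipticCurves.PadicSigmaThree.Universal

open _root_.WeierstrassCurve Literature.RingTheory.AdicTopology Literature.RingTheory.HenselLemma Chart

/-! ## §1 Hensel; the Frobenius lift -/

/-- **One-variable Hensel lemma in an `I`-adically complete ring**: a polynomial `Q` with `Q(x) ∈ I` and
`Q'(x)` a unit has a root `y ≡ x (mod I)`. (The tree's multivariate Newton contraction
`existsUnique_zero_of_newton` with a single unknown.) [cite: Eisenbud1995, Thm. 7.3 (Hensel's lemma)] -/
theorem exists_root_of_newton {A : Type*} [CommRing A] (I : Ideal A) [IsAdicComplete I A] (Q : Polynomial A)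
    (x : A) (h0 : Q.eval x ∈ I) (hd : IsUnit (Q.derivative.eval x)) :
    ∃ y : A, Q.eval y = 0 ∧ y - x ∈ I := by
  classical
  set Φ : (Unit → A) → (Unit → A) := fun c _ => Q.eval (x + c ()) with hΦ
  set J : Matrix Unit Unit A := Matrix.of fun _ _ => Q.derivative.eval x with hJ
  have hJdet : IsUnit J.det := by rw [Matrix.det_unique]; exact hd
  have hmv : ∀ v : Unit → A, J.mulVec v () = Q.derivative.eval x * v () := fun v => by
    simp [hJ, Matrix.mulVec, dotProduct]
  obtain ⟨c, ⟨hcI, hc0⟩, -⟩ := existsUnique_zero_of_newton I Φ J hJdet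
    (fun _ => by simpa [hΦ] using h0)
    (fun r c c' hc hc' hcc' q => by
      obtain ⟨k, hk⟩ := Q.binomExpansion (x + c' ()) (c () - c' ())
      have hder : c' () ∣ Q.derivative.eval (x + c' ()) - Q.derivative.eval x := by
        have := Polynomial.sub_dvd_eval_sub (x + c' ()) x Q.derivative
        rwa [add_sub_cancel_left] at this
      obtain ⟨m, hm⟩ := hder
      have e : (Φ c - Φ c' - J.mulVec (c - c')) q =
          (c () - c' ()) * (c' () * m) + k * ((c () - c' ()) * (c () - c' ())) := by
        have hq : q = () := rfl
        subst hq
        rw [Pi.sub_apply, Pi.sub_apply, hmv, Pi.sub_apply, hΦ]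
        simp only
        rw [show x + c () = x + c' () + (c () - c' ()) by ring, hk, eq_add_of_sub_eq hm]
        ring
      rw [e, pow_succ]
      refine add_mem (Ideal.mul_mem_mul (hcc' ()) (I.mul_mem_right _ (hc' ()))) ?_
      exact I ^ r * I |>.mul_mem_left _ (Ideal.mul_mem_mul (hcc' ()) (I.sub_mem (hc ()) (hc' ()))))
  exact ⟨x + c (), by simpa [hΦ] using congrFun hc0 (), by rw [add_sub_cancel_left]; exact hcI ()⟩

/-- The quartic `27·Ψ₃(y/3)` of an `a₂`-model, as a polynomial in `y`. [cite: BlakestadGrant2023, Prop. 7] -/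
theorem quartic_eval {A : Type*} [CommRing A] (a₂ a₄ a₆ y : A) :
    (Polynomial.X ^ 4 + Polynomial.C (4 * a₂) * Polynomial.X ^ 3 + Polynomial.C (18 * a₄) * Polynomial.X ^ 2 +
      Polynomial.C (108 * a₆) * Polynomial.X + Polynomial.C (27 * (4 * a₂ * a₆ - a₄ ^ 2))).eval y =
      y ^ 4 + 4 * a₂ * y ^ 3 + 18 * a₄ * y ^ 2 + 108 * a₆ * y + 27 * (4 * a₂ * a₆ - a₄ ^ 2) := by
  simp only [Polynomial.eval_add, Polynomial.eval_mul, Polynomial.eval_pow, Polynomial.eval_C, Polynomial.eval_X]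

/-- Its derivative. [cite: SilvermanAEC2009, III Ex. 3.7] -/
theorem quartic_derivative_eval {A : Type*} [CommRing A] (a₂ a₄ a₆ y : A) :
    (Polynomial.derivative (Polynomial.X ^ 4 + Polynomial.C (4 * a₂) * Polynomial.X ^ 3 +
      Polynomial.C (18 * a₄) * Polynomial.X ^ 2 + Polynomial.C (108 * a₆) * Polynomial.X +
      Polynomial.C (27 * (4 * a₂ * a₆ - a₄ ^ 2)))).eval y =
      4 * y ^ 3 + 12 * a₂ * y ^ 2 + 36 * a₄ * y + 108 * a₆ := by
  simp only [Polynomial.derivative_add, Polynomial.derivative_mul, Polynomial.derivative_X_pow, Polynomial.derivative_C,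
    Polynomial.derivative_X, Polynomial.eval_add, Polynomial.eval_mul, Polynomial.eval_pow, Polynomial.eval_C,
    Polynomial.eval_X, zero_mul, zero_add, mul_one, add_zero]
  push_cast
  ring

/-- **The root `Y' ≡ Y³ (mod 3)` of the quartic of the quotient model `𝓔'`** exists in `R̂₃`:
`Q_{𝓔'}(Y³) ≡ Y⁹(Y³ + a₂') ≡ 0` and `Q'_{𝓔'}(Y³) ≡ Y⁹ ∈ R̂₃ˣ (mod 3)`. [cite: BlakestadGrant2023, Def. 8] -/
theorem exists_frobY : ∃ Y' : completeRing,
    Y' ^ 4 + 4 * univChart.a2' * Y' ^ 3 + 18 * univChart.a4' * Y' ^ 2 + 108 * univChart.a6' * Y' +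
      27 * (4 * univChart.a2' * univChart.a6' - univChart.a4' ^ 2) = 0 ∧
    Y' - univY ^ 3 ∈ Ideal.span {(3 : completeRing)} := by
  set I := Ideal.span {(3 : completeRing)} with hI
  have h3I : (3 : completeRing) ∈ I := Ideal.mem_span_singleton_self _
  set Q : Polynomial completeRing := Polynomial.X ^ 4 + Polynomial.C (4 * univChart.a2') * Polynomial.X ^ 3 +
    Polynomial.C (18 * univChart.a4') * Polynomial.X ^ 2 + Polynomial.C (108 * univChart.a6') * Polynomial.X +
    Polynomial.C (27 * (4 * univChart.a2' * univChart.a6' - univChart.a4' ^ 2)) with hQ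
  -- `Q(Y³) = Y⁹(Y³ + a₂') + 3·(…)` with `Y³ + a₂' = (a₂' - a₂³) + (a₂ + Y)(a₂² - a₂Y + Y²)`
  have h0 : Q.eval (univY ^ 3) ∈ I := by
    rw [hQ, quartic_eval]
    have ha : univChart.a2' + univY ^ 3 ∈ I := by
      have e : univChart.a2' + univY ^ 3 = (univChart.a2' - univChart.a2 ^ 3) +
          (univChart.a2 + univChart.Y) * (univChart.a2 ^ 2 - univChart.a2 * univChart.Y + univChart.Y ^ 2) := by
        rw [univChart_Y]; ring
      rw [e, univChart.a2'_sub_cube, univChart.a2_add_Y]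
      exact add_mem (I.mul_mem_right _ h3I) (I.mul_mem_right _ (I.mul_mem_right _ h3I))
    have e : (univY ^ 3) ^ 4 + 4 * univChart.a2' * (univY ^ 3) ^ 3 + 18 * univChart.a4' * (univY ^ 3) ^ 2 +
        108 * univChart.a6' * univY ^ 3 + 27 * (4 * univChart.a2' * univChart.a6' - univChart.a4' ^ 2) =
        (univY ^ 3) ^ 3 * (univChart.a2' + univY ^ 3) +
          3 * (univChart.a2' * (univY ^ 3) ^ 3 + 6 * univChart.a4' * (univY ^ 3) ^ 2 + 36 * univChart.a6' * univY ^ 3 +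
            9 * (4 * univChart.a2' * univChart.a6' - univChart.a4' ^ 2)) := by ring
    rw [e]
    exact add_mem (I.mul_mem_left _ ha) (I.mul_mem_right _ h3I)
  have hd : IsUnit (Q.derivative.eval (univY ^ 3)) := by
    rw [hQ, quartic_derivative_eval]
    refine isUnit_of_isUnit_mk I ?_
    have e : 4 * (univY ^ 3) ^ 3 + 12 * univChart.a2' * (univY ^ 3) ^ 2 + 36 * univChart.a4' * univY ^ 3 +
        108 * univChart.a6' = 4 * (univY ^ 3) ^ 3 +
        3 * (4 * univChart.a2' * (univY ^ 3) ^ 2 + 12 * univChart.a4' * univY ^ 3 + 36 * univChart.a6') := by ring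
    have hz : Ideal.Quotient.mk I (3 * (4 * univChart.a2' * (univY ^ 3) ^ 2 + 12 * univChart.a4' * univY ^ 3 +
        36 * univChart.a6')) = 0 := Ideal.Quotient.eq_zero_iff_mem.mpr (I.mul_mem_right _ h3I)
    rw [e, map_add, hz, add_zero, map_mul, map_pow, map_pow]
    have h4 : IsUnit (Ideal.Quotient.mk I 4) := by
      have := (isUnit_two.pow 2).map (Ideal.Quotient.mk I)
      rwa [show (2 : completeRing) ^ 2 = 4 by norm_num] at this
    exact h4.mul (((isUnit_univY.map _).pow 3).pow 3)
  obtain ⟨y, hy, hyx⟩ := exists_root_of_newton I Q (univY ^ 3) h0 hd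
  refine ⟨y, ?_, hyx⟩
  rwa [hQ, quartic_eval] at hy

/-- **`Y'`**, the canonical parameter of the quotient model `𝓔'` (`= 3·x(P')` for its canonical subgroup),
chosen by Hensel. [cite: BlakestadGrant2023, Def. 8] -/
def frobY : completeRing := exists_frobY.choose

/-- `Q_{𝓔'}(Y') = 0`. [cite: BlakestadGrant2023, Def. 8] -/
theorem frobY_quartic : frobY ^ 4 + 4 * univChart.a2' * frobY ^ 3 + 18 * univChart.a4' * frobY ^ 2 +
    108 * univChart.a6' * frobY + 27 * (4 * univChart.a2' * univChart.a6' - univChart.a4' ^ 2) = 0 :=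
  exists_frobY.choose_spec.1

/-- `Y' ≡ Y³ (mod 3)`. [cite: BlakestadGrant2023, Def. 8] -/
theorem frobY_sub_mem : frobY - univY ^ 3 ∈ Ideal.span {(3 : completeRing)} := exists_frobY.choose_spec.2

/-- `Y'` is a unit. [cite: BlakestadGrant2023, Def. 8] -/
theorem isUnit_frobY : IsUnit frobY := by
  refine isUnit_of_isUnit_mk (Ideal.span {(3 : completeRing)}) ?_
  rw [(Ideal.Quotient.eq (I := Ideal.span {(3 : completeRing)})).mpr frobY_sub_mem, map_pow]
  exact (isUnit_univY.map _).pow 3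

/-- **The Frobenius lift `α : R̂₃ → R̂₃`, `(Y, A₄, A₆) ↦ (Y', a₄', a₆')`** (Blakestad–Grant Def. 8 for the
chart). [cite: BlakestadGrant2023, Def. 8] -/
def frobeniusLift : completeRing →+* completeRing := specialize frobY univChart.a4' univChart.a6' isUnit_frobY

/-- **`α(x) ≡ x³ (mod 3)` for all `x ∈ R̂₃`.** [cite: BlakestadGrant2023, Def. 8] -/
theorem frobeniusLift_sub_pow_mem (x : completeRing) : frobeniusLift x - x ^ 3 ∈ Ideal.span {(3 : completeRing)} := by
  refine specialize_sub_pow_mem _ _ _ _ frobY_sub_mem ?_ ?_ x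
  · rw [← univChart_A4, univChart.a4'_sub_cube]; exact Ideal.mem_span_singleton.mpr (dvd_mul_right _ _)
  · rw [← univChart_A6, univChart.a6'_sub_cube]; exact Ideal.mem_span_singleton.mpr (dvd_mul_right _ _)

/-- **`α_*𝓔 = 𝓔'`**: the Frobenius lift carries the universal curve to the quotient model — the chart of
`𝓔'` is `(Y', a₄', a₆')` (`a2_eq_of_quartic`). [cite: BlakestadGrant2023, Prop. 7] -/
theorem universalCurve_map_frobeniusLift : universalCurve.map frobeniusLift = univChart.isogCurve := by
  have hY : (univChart.map frobeniusLift).Y = frobY := specialize_univY _ _ _ _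
  have h4 : (univChart.map frobeniusLift).A4 = univChart.a4' := specialize_univA4 _ _ _ _
  have h6 : (univChart.map frobeniusLift).A6 = univChart.a6' := specialize_univA6 _ _ _ _
  have ha2 : univChart.a2' = (univChart.map frobeniusLift).a2 := by
    refine (univChart.map frobeniusLift).a2_eq_of_quartic ?_
    rw [hY, h4, h6]
    exact frobY_quartic
  rw [show universalCurve = univChart.curve from rfl, ← Chart.curve_map]
  exact WeierstrassCurve.ext rfl ha2.symm rfl h4 h6

/-! ## §2 Thm 1 for the universal ordinary `a₂`-curve -/

/-- **Blakestad–Grant's Thm 1 at `p = 3`: for every even zeta series `Λ` of the universal ordinary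
`a₂`-curve `𝓔/R̂₃`, `exp(∫ζ̃ω)` has all its coefficients in `R̂₃ ⊆ K₃`.** The Frobenius `3`-isogeny data:
`α = frobeniusLift`, `T = isogParam`, `u = unitSeries` of the universal chart (`T ≡ t³`, `u ≡ 1` over
`R̂₃`), `π = -3/Y`, `T₀ = 6A₄/Y + 36A₆/Y²`; the identities `ω'(T)dT = πω` and
`(π²ρ'(T) - 3ρ + T₀)u² = uD²u - (Du)²` hold over `K₃` (where `1/3` exists) by
`X1/PadicSigmaThreeFormalIsogenyChart.lean`. [cite: BlakestadGrant2023, Thm. 1] -/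
theorem coeff_exp_sigmaExpArg_mem_intSubring {β : completeRing} {Λ : PowerSeries completeRing}
    (h0 : constantCoeff Λ = 1) (hev : rescale (-1 : completeRing) Λ = Λ)
    (hΛ : X * d⁄dX completeRing Λ - Λ = -((universalCurve.formalXMulSq - C β * X ^ 2) * universalCurve.formalInvDiff))
    (n : ℕ) :
    coeff n ((exp completeRingQ).subst ((universalCurve.map (algebraMap completeRing completeRingQ)).sigmaExpArg
      (PowerSeries.map (algebraMap completeRing completeRingQ) Λ))) ∈ intSubring := by
  set ι := algebraMap completeRing completeRingQ with hι
  set dK : Chart completeRingQ := univChart.map ι with hdK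
  set th : completeRingQ := ↑(isUnit_three_completeRingQ.unit⁻¹) with hth
  have h3 : (3 : completeRingQ) * th = 1 := isUnit_three_completeRingQ.mul_val_inv
  have hcurve : dK.curve = universalCurve.map ι := Chart.curve_map _ ι
  have hisog : dK.isogCurve = (universalCurve.map frobeniusLift).map ι := by
    rw [hdK, Chart.isogCurve_map, universalCurve_map_frobeniusLift]
  have hT : dK.isogParam = PowerSeries.map ι univChart.isogParam := Chart.isogParam_map _ ι
  have hu : dK.unitSeries = PowerSeries.map ι univChart.unitSeries := Chart.unitSeries_map _ ι
  have hTω := dK.formalInvDiff_isogCurve_subst h3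
  rw [hisog, hT, hcurve, Chart.map_piConst] at hTω
  have hB := dK.formalXReg_rel h3
  rw [hisog, hT, hcurve, hu, Chart.map_piConst, Chart.map_T0] at hB
  exact coeff_exp_sigmaExpArg_universalCurve_mem' frobeniusLift frobeniusLift_sub_pow_mem
    univChart.constantCoeff_isogParam univChart.coeff_isogParam_sub_mem univChart.constantCoeff_unitSeries
    univChart.coeff_one_unitSeries univChart.coeff_succ_unitSeries_mem hTω hB h0 hev hΛ n

end Literature.NumberTheory.EllipticCurves.PadicSigmaThree.Universal

/-! ## §3 Specialisation to `ℤ₃` and the named fact -/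

namespace Literature.NumberTheory.EllipticCurves.PadicSigmaThree

open _root_.WeierstrassCurve Literature.RingTheory.AdicTopology Universal

/-- The Hasse coefficient at `3` of an `a₁ = a₃ = 0` model is `4a₂`. [cite: SilvermanAEC2009, V.4.1] -/
theorem hasseCoeff_three_of_isCharNeTwoNF {A : Type*} [CommRing A] (W : WeierstrassCurve A) [W.IsCharNeTwoNF] :
    W.hasseCoeff 3 = 4 * W.a₂ := by
  rw [WeierstrassCurve.hasseCoeff, show (3 - 1) / 2 = 1 from rfl, show 3 - 1 = 2 from rfl, pow_one, Cubic.coeff_eq_b]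
  simp [WeierstrassCurve.twoTorsionPolynomial, WeierstrassCurve.b₂]

/-- **The Mazur–Tate sigma pair exists for every `3`-integral ordinary `a₂`-model over `ℚ₃`** (the local
statement to which `PadicSigmaThreeReductionProofs` reduces the named fact): Blakestad–Grant's Thm 15 for the chart — Hensel in `ℤ₃` puts the
model into the universal family (`Y ↦ y₀`, `y₀ ≡ -a₂`, `Ψ₃(y₀/3) = 0`), Thm 2's even zeta series and Thm 1's
integral `exp ∫ζ̃ω` specialise, and `isMazurTateSigmaPair_sigmaOfZeta` concludes.
[cite: MazurSteinTate2006, Thm. 1.3] [cite: BlakestadGrant2023, Thm. 15] -/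
theorem exists_isMazurTateSigmaPair_three (V : WeierstrassCurve ℚ_[3]) [V.IsIntegral ℤ_[3]] [V.IsCharNeTwoNF]
    (_hΔ : ‖V.Δ‖ = 1) (hc : ‖coeff 2 V.formalOmega‖ = 1) :
    ∃ σ : ℚ_[3]⟦X⟧, ∃ c : ℚ_[3], V.IsMazurTateSigmaPair σ c := by
  haveI := padicInt_isAdicComplete_span_p 3
  -- the integral model `W₀/ℤ₃`
  set W₀ : WeierstrassCurve ℤ_[3] := integralModel ℤ_[3] V with hW₀
  have hV : W₀.map (algebraMap ℤ_[3] ℚ_[3]) = V := baseChange_integralModel_eq ℤ_[3] V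
  have hinj : Function.Injective (algebraMap ℤ_[3] ℚ_[3]) := IsFractionRing.injective ℤ_[3] ℚ_[3]
  haveI : W₀.IsCharNeTwoNF := by
    refine ⟨hinj ?_, hinj ?_⟩
    · rw [map_zero, ← map_a₁, hV, V.a₁_of_isCharNeTwoNF]
    · rw [map_zero, ← map_a₃, hV, V.a₃_of_isCharNeTwoNF]
  -- `a₂` is a unit (ordinarity)
  have hcoe : coeff 2 V.formalOmega = ((coeff (3 - 1) W₀.formalInvDiff : ℤ_[3]) : ℚ_[3]) := by
    rw [← V.formalInvDiff_eq_formalOmega, ← hV, ← W₀.map_formalInvDiff, coeff_map]; rfl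
  have hA : IsUnit (coeff (3 - 1) W₀.formalInvDiff) := by
    rw [PadicInt.isUnit_iff, PadicInt.norm_def, ← hcoe]; exact hc
  have ha₂ : IsUnit W₀.a₂ := by
    have h := (UniversalOrdinary.isUnit_hasseCoeff_iff_isUnit_coeff_formalInvDiff 3 (by norm_num) W₀).mpr hA
    rw [hasseCoeff_three_of_isCharNeTwoNF] at h
    exact isUnit_of_mul_isUnit_right h
  -- Hensel in `ℤ₃`: `y₀ ≡ -a₂`, `Q(y₀) = 0`
  set I : Ideal ℤ_[3] := Ideal.span {((3 : ℕ) : ℤ_[3])} with hI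
  have h3I : (3 : ℤ_[3]) ∈ I := by exact Ideal.mem_span_singleton_self _
  obtain ⟨y₀, hy₀, hy₀a⟩ := exists_root_of_newton I
    (Polynomial.X ^ 4 + Polynomial.C (4 * W₀.a₂) * Polynomial.X ^ 3 + Polynomial.C (18 * W₀.a₄) * Polynomial.X ^ 2 +
      Polynomial.C (108 * W₀.a₆) * Polynomial.X + Polynomial.C (27 * (4 * W₀.a₂ * W₀.a₆ - W₀.a₄ ^ 2))) (-W₀.a₂)
    (by
      rw [quartic_eval, show (-W₀.a₂) ^ 4 + 4 * W₀.a₂ * (-W₀.a₂) ^ 3 + 18 * W₀.a₄ * (-W₀.a₂) ^ 2 +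
        108 * W₀.a₆ * -W₀.a₂ + 27 * (4 * W₀.a₂ * W₀.a₆ - W₀.a₄ ^ 2) = 3 * (-(W₀.a₂ ^ 2 - 3 * W₀.a₄) ^ 2) by ring]
      exact I.mul_mem_right _ h3I)
    (by
      rw [quartic_derivative_eval, show 4 * (-W₀.a₂) ^ 3 + 12 * W₀.a₂ * (-W₀.a₂) ^ 2 + 36 * W₀.a₄ * -W₀.a₂ + 108 * W₀.a₆ =
        8 * W₀.a₂ ^ 3 + 3 * (-(12 * W₀.a₄ * W₀.a₂) + 36 * W₀.a₆) by ring]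
      refine isUnit_of_isUnit_mk I ?_
      rw [map_add, show Ideal.Quotient.mk I (3 * (-(12 * W₀.a₄ * W₀.a₂) + 36 * W₀.a₆)) = 0 from
        Ideal.Quotient.eq_zero_iff_mem.mpr (I.mul_mem_right _ h3I), add_zero, map_mul, map_pow]
      refine (IsUnit.map _ ?_).mul ((ha₂.map _).pow 3)
      exact isUnit_natCast_of_coprime (R := ℤ_[3]) (p := 3) (m := 8) (by norm_num))
  have hy₀u : IsUnit y₀ := by
    refine isUnit_of_isUnit_mk I ?_
    rw [show y₀ = (y₀ - -W₀.a₂) + -W₀.a₂ by ring, map_add, Ideal.Quotient.eq_zero_iff_mem.mpr hy₀a, zero_add, map_neg,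
      IsUnit.neg_iff]
    exact ha₂.map _
  -- `ρ = specialize y₀ a₄ a₆` and `ρ_*𝓔 = W₀`
  set ρ : completeRing →+* ℤ_[3] := specialize y₀ W₀.a₄ W₀.a₆ hy₀u with hρdef
  have hρY : (univChart.map ρ).Y = y₀ := specialize_univY _ _ _ _
  have hρ4 : (univChart.map ρ).A4 = W₀.a₄ := specialize_univA4 _ _ _ _
  have hρ6 : (univChart.map ρ).A6 = W₀.a₆ := specialize_univA6 _ _ _ _
  have ha2 : W₀.a₂ = (univChart.map ρ).a2 := by
    refine (univChart.map ρ).a2_eq_of_quartic ?_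
    rw [hρY, hρ4, hρ6]
    rw [quartic_eval] at hy₀; exact hy₀
  have hρ : universalCurve.map ρ = W₀ := by
    rw [show universalCurve = univChart.curve from rfl, ← Chart.curve_map]
    exact WeierstrassCurve.ext W₀.a₁_of_isCharNeTwoNF.symm ha2.symm W₀.a₃_of_isCharNeTwoNF.symm hρ4 hρ6
  -- universal zeta data and integrality, specialised along `ρ`
  obtain ⟨β, Λ, h0, hev, hΛ⟩ := exists_even_zetaSeries_universalCurve
  obtain ⟨ρK, hρK⟩ := exists_ringHom_completeRingQ_padic ρ
  have hcomp : ρK.comp (algebraMap completeRing completeRingQ) = (algebraMap ℤ_[3] ℚ_[3]).comp ρ :=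
    RingHom.ext fun x => by rw [RingHom.comp_apply, RingHom.comp_apply, hρK x]; rfl
  set Λ₀ : ℤ_[3]⟦X⟧ := PowerSeries.map ρ Λ with hΛ₀def
  have h0' : constantCoeff Λ₀ = 1 := constantCoeff_map_eq_one ρ h0
  have hev' : rescale (-1 : ℤ_[3]) Λ₀ = Λ₀ := rescale_neg_one_map_of_eq ρ hev
  have hΛ₀ : X * d⁄dX ℤ_[3] Λ₀ - Λ₀ = -((W₀.formalXMulSq - C (ρ β) * X ^ 2) * W₀.formalInvDiff) := by
    have h := universalCurve.map_zetaSeries_eq ρ hΛ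
    rwa [hρ] at h
  have hcurve : (universalCurve.map (algebraMap completeRing completeRingQ)).map ρK = V := by
    rw [map_map, hcomp, ← map_map, hρ, hV]
  have hser : PowerSeries.map ρK (PowerSeries.map (algebraMap completeRing completeRingQ) Λ) =
      PowerSeries.map (algebraMap ℤ_[3] ℚ_[3]) Λ₀ := by
    ext n
    rw [coeff_map, coeff_map, hρK, hΛ₀def, coeff_map, coeff_map]
    rfl
  have hexp : PowerSeries.map ρK ((exp completeRingQ).subst
      ((universalCurve.map (algebraMap completeRing completeRingQ)).sigmaExpArg
        (PowerSeries.map (algebraMap completeRing completeRingQ) Λ))) =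
      (exp ℚ_[3]).subst (V.sigmaExpArg (PowerSeries.map (algebraMap ℤ_[3] ℚ_[3]) Λ₀)) := by
    rw [Literature.RingTheory.FormalGroups.map_exp_subst ρK (constantCoeff_sigmaExpArg _), map_sigmaExpArg, hcurve, hser]
  have hint₀ : ∀ n, ‖coeff n ((exp ℚ_[3]).subst (V.sigmaExpArg (PowerSeries.map (algebraMap ℤ_[3] ℚ_[3]) Λ₀)))‖ ≤ 1 := by
    intro n
    rw [← hexp, coeff_map]
    exact norm_le_one_of_mem_intSubring hρK (coeff_exp_sigmaExpArg_mem_intSubring h0 hev hΛ n)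
  exact ⟨_, _, isMazurTateSigmaPair_sigmaOfZeta V W₀ hV h0' hev' hΛ₀ hint₀⟩

end Literature.NumberTheory.EllipticCurves.PadicSigmaThree

namespace Literature.NumberTheory.EllipticCurves

/-- **DISCHARGE: `mazur_tate_sigma_exists_odd` holds** — the Mazur–Tate sigma pair exists at every odd
prime of good ordinary reduction of every elliptic curve over `ℚ` (Mazur–Tate 1991 Thm 3.1 / Mazur–Stein–Tate
2006 Thm 1.3, existence half): `p ≥ 5` is the tree's Blakestad–Grant theorem, `p = 3` is
`PadicSigmaThree.exists_isMazurTateSigmaPair_three` through `mazur_tate_sigma_exists_odd_of_exists_charNeTwoNF_three`.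
[cite: MazurSteinTate2006, Thm. 1.3] [cite: MazurTate1991, Thm. 3.1] -/
theorem mazur_tate_sigma_exists_odd_holds : mazur_tate_sigma_exists_odd :=
  mazur_tate_sigma_exists_odd_of_exists_charNeTwoNF_three fun V _ _ hΔ hc =>
    PadicSigmaThree.exists_isMazurTateSigmaPair_three V hΔ hc

end Literature.NumberTheory.EllipticCurves

end

/-! ## Part `PadicSigmaThreeConsequences` (= `Summits/BirchSwinnertonDyer/Rank1Residual/X1/PadicSigmaThreeConsequences.lean`, declarations verbatim) -/

noncomputable section

open PowerSeries WeierstrassCurve Literature.NumberTheory.EllipticCurves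

namespace Literature.NumberTheory.EllipticCurves.PadicSigmaThree

/-- **Exactly one Mazur–Tate pair at every odd good ordinary prime**, unconditionally.
[cite: MazurSteinTate2006, Thm. 1.3] -/
theorem mazur_tate_sigma_existsUnique_odd (W : WeierstrassCurve ℚ) [W.IsElliptic] [W.IsGloballyMinimal]
    (p : ℕ) [Fact p.Prime] (hp2 : p ≠ 2) (hgood : W.HasGoodReductionAtPrime p) (hord : ¬ (p : ℤ) ∣ W.frobeniusTrace p) :
    ∃! σc : ℚ_[p]⟦X⟧ × ℚ_[p], (W.baseChange ℚ_[p]).IsMazurTateSigmaPair σc.1 σc.2 :=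
  mazur_tate_sigma_existsUnique_of_odd mazur_tate_sigma_exists_odd_holds W p hp2 hgood hord

/-- **The tree's chosen pair `(padicSigma, padicSigmaConst)` of `W ⊗ ℚ_p` IS the Mazur–Tate pair** at every
odd good ordinary prime, unconditionally. [cite: MazurSteinTate2006, Thm. 1.3] -/
theorem isMazurTateSigmaPair_padicSigma_odd (W : WeierstrassCurve ℚ) [W.IsElliptic] [W.IsGloballyMinimal]
    (p : ℕ) [Fact p.Prime] (hp2 : p ≠ 2) (hgood : W.HasGoodReductionAtPrime p) (hord : ¬ (p : ℤ) ∣ W.frobeniusTrace p) :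
    (W.baseChange ℚ_[p]).IsMazurTateSigmaPair (W.baseChange ℚ_[p]).padicSigma (W.baseChange ℚ_[p]).padicSigmaConst :=
  isMazurTateSigmaPair_padicSigma_of_odd mazur_tate_sigma_exists_odd_holds W p hp2 hgood hord

/-- **THE canonical cyclotomic `p`-adic height exists at every odd good ordinary prime** (`p = 3` included),
unconditionally. [cite: Balakrishnan2016, §2 (display before (2.2))] [cite: MazurSteinTate2006, §1 eq. (1.1)] -/
theorem exists_isCanonical_odd (W : WeierstrassCurve ℚ) [W.IsElliptic] [W.IsGloballyMinimal]
    (p : ℕ) [Fact p.Prime] (hp2 : p ≠ 2) (hgood : W.HasGoodReductionAtPrime p) (hord : ¬ (p : ℤ) ∣ W.frobeniusTrace p) :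
    ∃ D : PAdicHeightData W p, D.IsCanonical :=
  exists_isCanonical_of_odd mazur_tate_sigma_exists_odd_holds W p hp2 hgood hord

/-- … and it is unique. [cite: Balakrishnan2016, §2 (display before (2.2))] -/
theorem existsUnique_isCanonical_odd (W : WeierstrassCurve ℚ) [W.IsElliptic] [W.IsGloballyMinimal]
    (p : ℕ) [Fact p.Prime] (hp2 : p ≠ 2) (hgood : W.HasGoodReductionAtPrime p) (hord : ¬ (p : ℤ) ∣ W.frobeniusTrace p) :
    ∃! D : PAdicHeightData W p, D.IsCanonical :=
  existsUnique_isCanonical_of_odd mazur_tate_sigma_exists_odd_holds W p hp2 hgood hord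

end Literature.NumberTheory.EllipticCurves.PadicSigmaThree

end

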